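import Summits.CriticalPhenomena.Ising3D.TaylorTableCanonF
import Mathlib.Tactic.Linarith
import HarnessLib

/-!
# The TABLE layer of a derivative certificate, XXXI-bis: a CHEAP sufficient form of the layout side conditions `cellSideOK`
(cell `pub-ising3x`, seat boot-1 gen 18; BOX 3 spine — HOME/pub-ising3x-boot-1/b3spine-g17/IDENTITY-B3.md, final note)

HONEST FRAMING: lottery ticket; floor = tightest certified 3D Ising CFT bounds; no exact-solution
claim without a proof. Island framing: certified exclusion region at stated derivative order and
assumptions; not a determination of the 3D Ising critical exponents beyond that.

`cellSideOK E (ℓ, lo, hi, extra)` (TaylorTableCanonF) asks, for every extra head term `q`, that `q ∉ canonF ℓ lo E`, and that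
`extra` is duplicate-free — both decided by brute force. For a layout whose cells carry a few hundred extra head terms each
(the merged / deepened cells of a slaved-Ψ box: 37 rows with up to 392 extras, 8 500 in all) the kernel evaluation of that
Boolean re-evaluates the canonical list once per extra term and trips the kernel's memory guard as soon as a declaration holds
more than one such row («(kernel) excessive memory consumption detected», measured 2026-08-24). This file gives the cheap
sufficient test the emitters' data actually satisfies: the extra terms are listed in strictly ascending lexicographic order
(hence duplicate-free) and sit at levels `n ≥ E − lo` (hence are not canonical, by `mem_canonF`). `cellSideOK_of_fast` /
`all_cellSideOK_of_fast` turn the cheap Boolean into the one the table theorems consume; nothing downstream changes.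
Elementary list bookkeeping. [folklore]
-/

namespace Summit.CriticalPhenomena.Ising3D

open Literature.MathematicalPhysics.QuantumFieldTheory.ConformalBootstrap3D

/-! ### Strictly ascending index-pair lists -/

/-- Strict lexicographic comparison of index pairs `(n, j)`, as a Boolean. [folklore] -/
def pairLtB (a b : ℕ × ℕ) : Bool :=
  decide (a.1 < b.1) || (decide (a.1 = b.1) && decide (a.2 < b.2))

/-- `pairLtB` is irreflexive. [folklore] -/
theorem pairLtB_irrefl (a : ℕ × ℕ) : pairLtB a a = false := by
  simp [pairLtB]

/-- `pairLtB` is transitive. [folklore] -/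
theorem pairLtB_trans {a b c : ℕ × ℕ} (h₁ : pairLtB a b = true) (h₂ : pairLtB b c = true) : pairLtB a c = true := by
  simp only [pairLtB, Bool.or_eq_true, Bool.and_eq_true, decide_eq_true_eq] at h₁ h₂ ⊢
  omega

/-- A list of index pairs is strictly ascending (consecutive comparisons only: linear cost). [folklore] -/
def strictAscB : List (ℕ × ℕ) → Bool
  | [] => true
  | [_] => true
  | a :: b :: t => pairLtB a b && strictAscB (b :: t)

/-- Unfolding `strictAscB` on a list with at least two entries. [folklore] -/
theorem strictAscB_cons_cons (a b : ℕ × ℕ) (t : List (ℕ × ℕ)) :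
    strictAscB (a :: b :: t) = (pairLtB a b && strictAscB (b :: t)) := rfl

/-- A strictly ascending list: its head is below every later entry, and its tail is strictly ascending. [folklore] -/
theorem strictAscB_cons {a : ℕ × ℕ} {t : List (ℕ × ℕ)} (h : strictAscB (a :: t) = true) :
    (∀ b ∈ t, pairLtB a b = true) ∧ strictAscB t = true := by
  induction t generalizing a with
  | nil => simp [strictAscB]
  | cons b t ih =>
    rw [strictAscB_cons_cons, Bool.and_eq_true] at h
    obtain ⟨hab, ht⟩ := h
    refine ⟨?_, ht⟩
    intro c hc
    rcases List.mem_cons.mp hc with rfl | hc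
    · exact hab
    · exact pairLtB_trans hab ((ih ht).1 c hc)

/-- **A strictly ascending list of index pairs is duplicate-free.** [folklore] -/
theorem nodup_of_strictAscB {l : List (ℕ × ℕ)} (h : strictAscB l = true) : l.Nodup := by
  induction l with
  | nil => exact List.nodup_nil
  | cons a t ih =>
    obtain ⟨hlt, ht⟩ := strictAscB_cons h
    refine List.nodup_cons.mpr ⟨?_, ih ht⟩
    intro ha
    have := hlt a ha
    rw [pairLtB_irrefl] at this
    exact Bool.false_ne_true this

/-! ### The cheap side conditions -/

/-- The CHEAP side conditions of a layout entry `(ℓ, lo, hi, extra)`: `ℓ ≤ lo`; the extra head terms strictly ascending; each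
extra term in the descendant range `j ≤ ℓ + n` and at a level `n ≥ E − lo` (beyond the canonical levels). Linear in the
length of `extra`; no canonical list is evaluated. [folklore] -/
def cellSideOKFast (E : ℚ) (x : ℕ × ℚ × ℚ × List (ℕ × ℕ)) : Bool :=
  decide ((x.1 : ℚ) ≤ x.2.1) && strictAscB x.2.2.2 &&
    x.2.2.2.all fun q => decide (q.2 ≤ x.1 + q.1) && decide (E - x.2.1 ≤ (q.1 : ℚ))

/-- **The cheap side conditions imply `cellSideOK`.** A term at level `n ≥ E − lo` is not canonical (`mem_canonF`), and a
strictly ascending list is duplicate-free. [folklore] -/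
theorem cellSideOK_of_fast {E : ℚ} {x : ℕ × ℚ × ℚ × List (ℕ × ℕ)} (h : cellSideOKFast E x = true) :
    cellSideOK E x = true := by
  obtain ⟨ℓ, lo, hi, extra⟩ := x
  simp only [cellSideOKFast, Bool.and_eq_true, decide_eq_true_eq, List.all_eq_true] at h
  obtain ⟨⟨h1, h2⟩, h3⟩ := h
  simp only [cellSideOK, Bool.and_eq_true, decide_eq_true_eq, List.all_eq_true]
  refine ⟨⟨h1, nodup_of_strictAscB h2⟩, fun q hq => ⟨(h3 q hq).1, ?_⟩⟩
  intro hmem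
  have hlt := (mem_canonF.mp hmem).2
  have hge := (h3 q hq).2
  exact absurd hlt (not_lt.mpr hge)

/-- **Layout form**: if every entry of a layout passes the cheap test, every entry passes `cellSideOK` — the hypothesis of
`evenCellsS_of_layout` / `oddCellsS_of_layout`. [folklore] -/
theorem all_cellSideOK_of_fast {E : ℚ} {L : List (ℕ × ℚ × ℚ × List (ℕ × ℕ))} (h : L.all (cellSideOKFast E) = true) :
    L.all (cellSideOK E) = true :=
  List.all_eq_true.mpr fun x hx => cellSideOK_of_fast (List.all_eq_true.mp h x hx)

end Summit.CriticalPhenomena.Ising3D
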